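import Summits.AtomisticToContinuum.Crystallization.Theorems.DisclinationRationUniformPolytypeStabilityNearCellsAux

/-!
# `UniformPolytypeStability` (stmt-AtomisticToContinuum-15800), line `birth` (v2, cells): stub `stub_null`

Route `DisclinationRation`, crux `UniformPolytypeStability` (uniform harmonic stability of Lennard-Jones layered
polytypes `L(a,s,z)` on the box `a ∈ [47/50, 1]`, gaps in `[39a/50, 17a/20]`), line `birth`
(lead prover-line-stmt-AtomisticToContinuum-15800-0).  This `--supports` file proves the registered stub

  `stub_null : ∀ a s z, 47/50 ≤ a → a ≤ 1 → IsHaggSeq s → HeightBox a z → NullFactsAt a s z`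

over the line vocabulary `…Theorems.DisclinationRationUniformPolytypeStabilityDefs`: for every coefficient tensor
`C` and every finitely supported displacement `U : Idx → E3`, the cell null Lagrangians
`ι ↦ cellNull C a s z U ι = Σ_T vol_T · N_C(F_T)` (six sub-tetrahedra `T` per cell,
`F_T = Σ_{v ∈ T} U_v ⊗ ∇λ_v`) are finitely supported in the cell index and `∑' ι, cellNull C a s z U ι = 0` —
the DISCRETE NULL-LAGRANGIAN identity (`∫ M(∇ũ) = 0` for every `2 × 2` minor `M` and the piecewise-affine
interpolant `ũ` of `U` on the conforming cell triangulation), proved here purely algebraically: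

* CAUCHY–BINET IN A CELL (`StubNull.vol_nullMinor_four`, `StubNull.cellNull_expand`): with
  `∇λ_v = Σ_j ĝ_{v,j} b^j` (`gradVec`, `dualVec`) every minor of `F_T` is
  `Σ_{v,w ∈ T} U_v[p₁] U_w[p₂] Σ_{j<j'} (ĝ_v × ĝ_w)_{jj'} (b^j ∧ b^{j'})_q`,
  so `cellNull ι` is a sum over the `6 · 4 · 4` (sub-tetrahedron, vertex, vertex) incidences of pair pieces
  `Tf e e' (corner e) (corner e')` built from three slab bivectors `ω_{jj'}(k) = vol_k · (b^j(k) ∧ b^{j'}(k))`;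
* GEOMETRY OF THE DUAL FRAME (`StubNull.vol_wedge02`, `StubNull.vol_wedge12`): `vol_k · b^0∧b^2` and
  `vol_k · b^1∧b^2` are `s k` times constant antisymmetric matrices (`−σ v₂ / 6`, `σ v₁ / 6` as bivectors;
  `h_k ≠ 0`, `a ≠ 0`);
* REGROUPING BY THE FIRST VERTEX (`StubNearCells.tsum_corner`, `StubNull.tsum_nested`): after summing over cells
  and reindexing every incidence by the site of its first vertex, `∑' ι, cellNull ι = ∑' x, Φ x` with `Φ x`
  the explicit sum of the `96` incidences seen from the site `x` (twisted shifts of `x`, letters `s x.1`,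
  `s (x.1 − 1)`);
* THE POINTWISE IDENTITY (`StubNull.pointwise`): `Φ x = 0` for letters `±1` — after splitting the four sign cases
  the incidences around each of the `20` bonds at `x` cancel by `ring`: same-slab bonds purely combinatorially
  (closed vertex links), in-plane bonds between the slab above (`s x.1`) and the slab below (`s (x.1 − 1)`) thanks
  to the `σ`-proportionality of `ω_{02}`, `ω_{12}` (the bivector `ω_{01}` never survives).

Finite support: every piece carries a factor `U x p₁`.  Only `IsHaggSeq s`, `a ≠ 0` and `gap z k ≠ 0` (from
`HeightBox`) are used.  Everything is `[folklore]`; no definitions (the pieces `Tf`, `ω` are universally quantified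
functions pinned by equations); helper lemmas live in the sub-namespace `StubNull`; nothing here closes an item.
-/

noncomputable section

namespace Summit.AtomisticToContinuum.Crystallization.Theorems.UniformPolytypeStabilityCells

open scoped BigOperators Topology Classical InnerProductSpace
open Filter Set Function
open Literature.MathematicalPhysics.StatisticalMechanics

namespace StubNull

/-! ## Small algebra -/

/-- A list sum of finite sums is the finite sum of the list sums. [folklore] -/
theorem sum_map_sum {β γ : Type*} (L : List β) (S : Finset γ) (f : β → γ → ℝ) :
    (L.map fun b => ∑ i ∈ S, f b i).sum = ∑ i ∈ S, (L.map fun b => f b i).sum := by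
  induction L with
  | nil => simp
  | cons b L ih => simp only [List.map_cons, List.sum_cons, ih, Finset.sum_add_distrib]

/-- `∑'` of a three-level nested list sum of summable families (sub-tetrahedron, vertex, vertex) is the nested
list sum of the `∑'`s. [folklore] -/
theorem tsum_nested {β γ : Type*} (L : List (List β)) (f : β → β → γ → ℝ) (h : ∀ e e', Summable (f e e')) :
    ∑' c, (L.map fun T => (T.map fun e => (T.map fun e' => f e e' c).sum).sum).sum =
      (L.map fun T => (T.map fun e => (T.map fun e' => ∑' c, f e e' c).sum).sum).sum := by
  rw [StubNearCells.tsum_list_sum L (fun T c => (T.map fun e => (T.map fun e' => f e e' c).sum).sum)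
    fun T _ => StubNearCells.summable_list_sum T _ fun e _ =>
      StubNearCells.summable_list_sum T _ fun e' _ => h e e']
  refine congrArg List.sum (List.map_congr_left fun T _ => ?_)
  rw [StubNearCells.tsum_list_sum T (fun e c => (T.map fun e' => f e e' c).sum)
    fun e _ => StubNearCells.summable_list_sum T _ fun e' _ => h e e']
  refine congrArg List.sum (List.map_congr_left fun e _ => ?_)
  exact StubNearCells.tsum_list_sum T (fun e' c => f e e' c) fun e' _ => h e e'

/-! ## Geometry of the dual frame -/

section Frame

variable (a : ℝ) (s : ℤ → ℤ) (z : ℤ → ℝ) (k : ℤ)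

/-- Coordinates of the dual frame `b^0 = (σ/a, −σ/(a√3), −1/(3h))`, `b^1 = (0, 2σ/(a√3), −1/(3h))`,
`b^2 = (0, 0, 1/h)`. [folklore] -/
theorem dualVec_apply :
    (dualVec a s z k 0 0 = (s k : ℝ) / a ∧ dualVec a s z k 0 1 = -(s k : ℝ) / (a * Real.sqrt 3) ∧
      dualVec a s z k 0 2 = -1 / (3 * gap z k)) ∧
    (dualVec a s z k 1 0 = 0 ∧ dualVec a s z k 1 1 = 2 * (s k : ℝ) / (a * Real.sqrt 3) ∧
      dualVec a s z k 1 2 = -1 / (3 * gap z k)) ∧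
    (dualVec a s z k 2 0 = 0 ∧ dualVec a s z k 2 1 = 0 ∧ dualVec a s z k 2 2 = 1 / gap z k) := by
  refine ⟨⟨?_, ?_, ?_⟩, ⟨?_, ?_, ?_⟩, ⟨?_, ?_, ?_⟩⟩ <;> simp [dualVec]

variable {a} in
/-- `vol_k · (b^0 ∧ b^2)` is `σ_k` times the constant bivector of `−v₂/6 = −(a/2, a√3/2, 0)/6`. [folklore] -/
theorem vol_wedge02 (ha : a ≠ 0) (hk : gap z k ≠ 0) (q : Fin 3 × Fin 3) :
    subTetVol a z k *
        (dualVec a s z k 0 q.1 * dualVec a s z k 2 q.2 - dualVec a s z k 0 q.2 * dualVec a s z k 2 q.1) =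
      (s k : ℝ) * !![0, 0, a * Real.sqrt 3 / 12; 0, 0, -a / 12; -(a * Real.sqrt 3 / 12), a / 12, 0] q.1 q.2 := by
  obtain ⟨⟨a0, a1, a2⟩, -, ⟨c0, c1, c2⟩⟩ := dualVec_apply a s z k
  have h3 : Real.sqrt 3 ≠ 0 := by positivity
  obtain ⟨q1, q2⟩ := q
  fin_cases q1 <;> fin_cases q2 <;> simp [a0, a1, a2, c0, c1, c2, subTetVol] <;> field_simp

variable {a} in
/-- `vol_k · (b^1 ∧ b^2)` is `σ_k` times the constant bivector of `v₁/6 = (a, 0, 0)/6`. [folklore] -/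
theorem vol_wedge12 (ha : a ≠ 0) (hk : gap z k ≠ 0) (q : Fin 3 × Fin 3) :
    subTetVol a z k *
        (dualVec a s z k 1 q.1 * dualVec a s z k 2 q.2 - dualVec a s z k 1 q.2 * dualVec a s z k 2 q.1) =
      (s k : ℝ) * !![0, 0, 0; 0, 0, a / 6; 0, -(a / 6), 0] q.1 q.2 := by
  obtain ⟨-, ⟨b0, b1, b2⟩, ⟨c0, c1, c2⟩⟩ := dualVec_apply a s z k
  have h3 : Real.sqrt 3 ≠ 0 := by positivity
  obtain ⟨q1, q2⟩ := q
  fin_cases q1 <;> fin_cases q2 <;> simp [b0, b1, b2, c0, c1, c2, subTetVol] <;> field_simp <;> ring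

end Frame

/-! ## Cauchy–Binet in a cell -/

variable {a : ℝ} {s : ℤ → ℤ} {z : ℤ → ℝ} {C : Fin 3 × Fin 3 → Fin 3 × Fin 3 → ℝ}
  {U : Idx → EuclideanSpace ℝ (Fin 3)}
  {ω : Fin 3 → ℤ → Fin 3 × Fin 3 → ℝ}
  {Tf : (Corner × ℤ × ℤ × ℤ) → (Corner × ℤ × ℤ × ℤ) → Idx → Idx → ℝ}

/-- **Cauchy–Binet for one sub-tetrahedron.**  If `ω 0, ω 1, ω 2` are the slab bivectors
`vol_k · (b^0∧b^1, b^0∧b^2, b^1∧b^2)(k)` and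
`Tf e e' x y = Σ_{p,q} C p q · U x [p₁] · U y [p₂] · Σ_{j<j'} (ĝ_e × ĝ_{e'})_{jj'} ω_{jj'}` (slab read at
`x.1 − e.z`), then `vol · N_C(F_T)` for the sub-tetrahedron `T = [e₁, e₂, e₃, e₄]` of the cell `ι` is the
sum of the `16` pieces `Tf e e' (corner e) (corner e')` (bilinearity of minors in the rank-one summands
`U_v ⊗ ∇λ_v`, `∇λ_v = Σ_j ĝ_{v,j} b^j`; a `ring` identity). [folklore] -/
theorem vol_nullMinor_four
    (hω0 : ∀ k q, ω 0 k q = subTetVol a z k *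
      (dualVec a s z k 0 q.1 * dualVec a s z k 1 q.2 - dualVec a s z k 0 q.2 * dualVec a s z k 1 q.1))
    (hω1 : ∀ k q, ω 1 k q = subTetVol a z k *
      (dualVec a s z k 0 q.1 * dualVec a s z k 2 q.2 - dualVec a s z k 0 q.2 * dualVec a s z k 2 q.1))
    (hω2 : ∀ k q, ω 2 k q = subTetVol a z k *
      (dualVec a s z k 1 q.1 * dualVec a s z k 2 q.2 - dualVec a s z k 1 q.2 * dualVec a s z k 2 q.1))
    (hTf : ∀ e e' x y, Tf e e' x y = ∑ p : Fin 3 × Fin 3, ∑ q : Fin 3 × Fin 3, C p q * (U x p.1 * U y p.2 *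
      (((e.2.1 * e'.2.2.1 - e.2.2.1 * e'.2.1 : ℤ) : ℝ) * ω 0 (x.1 - ((e.1.2.2 : ℕ) : ℤ)) q +
        ((e.2.1 * e'.2.2.2 - e.2.2.2 * e'.2.1 : ℤ) : ℝ) * ω 1 (x.1 - ((e.1.2.2 : ℕ) : ℤ)) q +
        ((e.2.2.1 * e'.2.2.2 - e.2.2.2 * e'.2.2.1 : ℤ) : ℝ) * ω 2 (x.1 - ((e.1.2.2 : ℕ) : ℤ)) q)))
    (ι : CIdx) (e₁ e₂ e₃ e₄ : Corner × ℤ × ℤ × ℤ) :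
    subTetVol a z ι.1 * nullMinor C (subTetGrad a s z U ι [e₁, e₂, e₃, e₄]) =
      ([e₁, e₂, e₃, e₄].map fun e =>
        ([e₁, e₂, e₃, e₄].map fun e' => Tf e e' (cvert s ι e.1) (cvert s ι e'.1)).sum).sum := by
  obtain ⟨k, n₁, n₂⟩ := ι
  simp only [hTf, sum_map_sum, nullMinor, Finset.mul_sum]
  refine Finset.sum_congr rfl fun p _ => Finset.sum_congr rfl fun q _ => ?_
  simp only [List.map_cons, List.map_nil, List.sum_cons, List.sum_nil, cvert, add_sub_cancel_right, hω0, hω1,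
    hω2, subTetGrad, Matrix.add_apply, Matrix.zero_apply, Matrix.vecMulVec_apply, gradVec, PiLp.add_apply,
    PiLp.smul_apply, smul_eq_mul]
  push_cast
  ring

/-- **The cell term as `96` incidence pieces**:
`cellNull ι = Σ_{T} Σ_{e ∈ T} Σ_{e' ∈ T} Tf e e' (corner e) (corner e')`. [folklore] -/
theorem cellNull_expand
    (hω0 : ∀ k q, ω 0 k q = subTetVol a z k *
      (dualVec a s z k 0 q.1 * dualVec a s z k 1 q.2 - dualVec a s z k 0 q.2 * dualVec a s z k 1 q.1))
    (hω1 : ∀ k q, ω 1 k q = subTetVol a z k *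
      (dualVec a s z k 0 q.1 * dualVec a s z k 2 q.2 - dualVec a s z k 0 q.2 * dualVec a s z k 2 q.1))
    (hω2 : ∀ k q, ω 2 k q = subTetVol a z k *
      (dualVec a s z k 1 q.1 * dualVec a s z k 2 q.2 - dualVec a s z k 1 q.2 * dualVec a s z k 2 q.1))
    (hTf : ∀ e e' x y, Tf e e' x y = ∑ p : Fin 3 × Fin 3, ∑ q : Fin 3 × Fin 3, C p q * (U x p.1 * U y p.2 *
      (((e.2.1 * e'.2.2.1 - e.2.2.1 * e'.2.1 : ℤ) : ℝ) * ω 0 (x.1 - ((e.1.2.2 : ℕ) : ℤ)) q +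
        ((e.2.1 * e'.2.2.2 - e.2.2.2 * e'.2.1 : ℤ) : ℝ) * ω 1 (x.1 - ((e.1.2.2 : ℕ) : ℤ)) q +
        ((e.2.2.1 * e'.2.2.2 - e.2.2.2 * e'.2.2.1 : ℤ) : ℝ) * ω 2 (x.1 - ((e.1.2.2 : ℕ) : ℤ)) q)))
    (ι : CIdx) :
    cellNull C a s z U ι = (subTetTable.map fun T => (T.map fun e => (T.map fun e' =>
      Tf e e' (cvert s ι e.1) (cvert s ι e'.1)).sum).sum).sum := by
  simp only [cellNull, subTetTable, List.map_cons, List.map_nil, vol_nullMinor_four hω0 hω1 hω2 hTf ι]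

/-! ## The pointwise identity -/

/-- **The incidences seen from a site cancel.**  For letters `s = ±1` and slab bivectors with
`ω 1 k = s k · μ₁`, `ω 2 k = s k · μ₂` (`ω 0` arbitrary), the sum over the `96` (sub-tetrahedron, vertex `e`,
vertex `e'`) incidences of the pieces `Tf e e' x (twisted shift of x by e' − e, slab x.1 − e.z)` vanishes:
after the four sign cases of `s x.1`, `s (x.1 − 1)` the contributions around each of the `20` bonds at `x`
cancel (`ring`). [folklore] -/
theorem pointwise (hs : IsHaggSeq s) (μ₁ μ₂ : Fin 3 × Fin 3 → ℝ)
    (hμ1 : ∀ k q, ω 1 k q = (s k : ℝ) * μ₁ q) (hμ2 : ∀ k q, ω 2 k q = (s k : ℝ) * μ₂ q)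
    (hTf : ∀ e e' x y, Tf e e' x y = ∑ p : Fin 3 × Fin 3, ∑ q : Fin 3 × Fin 3, C p q * (U x p.1 * U y p.2 *
      (((e.2.1 * e'.2.2.1 - e.2.2.1 * e'.2.1 : ℤ) : ℝ) * ω 0 (x.1 - ((e.1.2.2 : ℕ) : ℤ)) q +
        ((e.2.1 * e'.2.2.2 - e.2.2.2 * e'.2.1 : ℤ) : ℝ) * ω 1 (x.1 - ((e.1.2.2 : ℕ) : ℤ)) q +
        ((e.2.2.1 * e'.2.2.2 - e.2.2.2 * e'.2.2.1 : ℤ) : ℝ) * ω 2 (x.1 - ((e.1.2.2 : ℕ) : ℤ)) q)))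
    (x : Idx) :
    (subTetTable.map fun T => (T.map fun e => (T.map fun e' =>
      Tf e e' x (x.1 + (((e'.1.2.2 : ℕ) : ℤ) - ((e.1.2.2 : ℕ) : ℤ)),
        x.2.1 + s (x.1 - ((e.1.2.2 : ℕ) : ℤ)) * (((e'.1.1 : ℕ) : ℤ) - ((e.1.1 : ℕ) : ℤ)),
        x.2.2 + s (x.1 - ((e.1.2.2 : ℕ) : ℤ)) * (((e'.1.2.1 : ℕ) : ℤ) - ((e.1.2.1 : ℕ) : ℤ)))).sum).sum).sum = 0 := by
  obtain ⟨m, i, j⟩ := x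
  simp only [hTf, sum_map_sum]
  refine Finset.sum_eq_zero fun p _ => Finset.sum_eq_zero fun q _ => ?_
  rcases hs m with h0 | h0 <;> rcases hs (m - 1) with h1 | h1 <;>
  · simp only [subTetTable, mkC, List.map_cons, List.map_nil, List.sum_cons, List.sum_nil]
    simp only [Fin.val_zero, Fin.val_one, Nat.cast_zero, Nat.cast_one, sub_zero, add_zero, sub_self, h0, h1,
      hμ1, hμ2]
    norm_num
    ring

end StubNull

open StubNull StubNearCells in
/-- **Stub `stub_null`** (registered signature): on the box, for letters `s = ±1` and every coefficient tensor `C`,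
the cell null Lagrangians `ι ↦ cellNull C a s z U ι` of a finitely supported displacement `U` are finitely
supported in the cell index and sum to zero — every quadratic minor is a discrete null Lagrangian on the conforming
cell triangulation (Cauchy–Binet in each cell, regrouping of the incidences by their first vertex, and the
pointwise cancellation `StubNull.pointwise`).  Of the box only `a ≠ 0` and `gap z k ≠ 0` are used. [folklore] -/
theorem stub_null : ∀ (a : ℝ) (s : ℤ → ℤ) (z : ℤ → ℝ), 47 / 50 ≤ a → a ≤ 1 → IsHaggSeq s → HeightBox a z →
    NullFactsAt a s z := by
  intro a s z ha _ hs hz C U hU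
  have ha0 : a ≠ 0 := by positivity
  have hgap : ∀ k, gap z k ≠ 0 := fun k => by
    have h := (hz k).1
    unfold gap
    intro h0
    linarith
  -- the slab bivectors `ω_{01}, ω_{02}, ω_{12}` and the incidence pieces `Tf`
  obtain ⟨ω, hω0, hω1, hω2⟩ : ∃ ω : Fin 3 → ℤ → Fin 3 × Fin 3 → ℝ,
      (∀ k q, ω 0 k q = subTetVol a z k *
        (dualVec a s z k 0 q.1 * dualVec a s z k 1 q.2 - dualVec a s z k 0 q.2 * dualVec a s z k 1 q.1)) ∧
      (∀ k q, ω 1 k q = subTetVol a z k *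
        (dualVec a s z k 0 q.1 * dualVec a s z k 2 q.2 - dualVec a s z k 0 q.2 * dualVec a s z k 2 q.1)) ∧
      (∀ k q, ω 2 k q = subTetVol a z k *
        (dualVec a s z k 1 q.1 * dualVec a s z k 2 q.2 - dualVec a s z k 1 q.2 * dualVec a s z k 2 q.1)) :=
    ⟨fun jj k q => if jj = 0 then subTetVol a z k *
        (dualVec a s z k 0 q.1 * dualVec a s z k 1 q.2 - dualVec a s z k 0 q.2 * dualVec a s z k 1 q.1)
      else if jj = 1 then subTetVol a z k *
        (dualVec a s z k 0 q.1 * dualVec a s z k 2 q.2 - dualVec a s z k 0 q.2 * dualVec a s z k 2 q.1)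
      else subTetVol a z k *
        (dualVec a s z k 1 q.1 * dualVec a s z k 2 q.2 - dualVec a s z k 1 q.2 * dualVec a s z k 2 q.1),
      fun k q => by simp, fun k q => by simp, fun k q => by simp⟩
  obtain ⟨Tf, hTf⟩ : ∃ Tf : (Corner × ℤ × ℤ × ℤ) → (Corner × ℤ × ℤ × ℤ) → Idx → Idx → ℝ, ∀ e e' x y,
      Tf e e' x y = ∑ p : Fin 3 × Fin 3, ∑ q : Fin 3 × Fin 3, C p q * (U x p.1 * U y p.2 *
        (((e.2.1 * e'.2.2.1 - e.2.2.1 * e'.2.1 : ℤ) : ℝ) * ω 0 (x.1 - ((e.1.2.2 : ℕ) : ℤ)) q +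
          ((e.2.1 * e'.2.2.2 - e.2.2.2 * e'.2.1 : ℤ) : ℝ) * ω 1 (x.1 - ((e.1.2.2 : ℕ) : ℤ)) q +
          ((e.2.2.1 * e'.2.2.2 - e.2.2.2 * e'.2.2.1 : ℤ) : ℝ) * ω 2 (x.1 - ((e.1.2.2 : ℕ) : ℤ)) q)) :=
    ⟨_, fun _ _ _ _ => rfl⟩
  have hT0 : ∀ e e' x y, x ∉ support U → Tf e e' x y = 0 := fun e e' x y hx => by
    rw [notMem_support] at hx
    simp [hTf, hx]
  have hμ1 : ∀ k q, ω 1 k q = (s k : ℝ) *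
      !![0, 0, a * Real.sqrt 3 / 12; 0, 0, -a / 12; -(a * Real.sqrt 3 / 12), a / 12, 0] q.1 q.2 :=
    fun k q => by rw [hω1]; exact vol_wedge02 s z k ha0 (hgap k) q
  have hμ2 : ∀ k q, ω 2 k q = (s k : ℝ) * !![0, 0, 0; 0, 0, a / 6; 0, -(a / 6), 0] q.1 q.2 :=
    fun k q => by rw [hω2]; exact vol_wedge12 s z k ha0 (hgap k) q
  have hcell := cellNull_expand hω0 hω1 hω2 hTf
  have hpt := pointwise hs _ _ hμ1 hμ2 hTf
  -- summability of the pieces on the cell side and on the site side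
  have hsum1 : ∀ e e' : Corner × ℤ × ℤ × ℤ,
      Summable fun ι : CIdx => Tf e e' (cvert s ι e.1) (cvert s ι e'.1) := fun e e' =>
    summable_corner (Tf e e') hU (fun x y hx _ => hT0 e e' x y hx) s e.1 e'.1
  have hsum2 : ∀ e e' : Corner × ℤ × ℤ × ℤ, Summable fun x : Idx =>
      Tf e e' x (x.1 + (((e'.1.2.2 : ℕ) : ℤ) - ((e.1.2.2 : ℕ) : ℤ)),
        x.2.1 + s (x.1 - ((e.1.2.2 : ℕ) : ℤ)) * (((e'.1.1 : ℕ) : ℤ) - ((e.1.1 : ℕ) : ℤ)),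
        x.2.2 + s (x.1 - ((e.1.2.2 : ℕ) : ℤ)) * (((e'.1.2.1 : ℕ) : ℤ) - ((e.1.2.1 : ℕ) : ℤ))) :=
    fun e e' => summable_along (Tf e e') hU (fun x y hx _ => hT0 e e' x y hx)
      (shift_injective (fun m => s (m - ((e.1.2.2 : ℕ) : ℤ))) _ _ _)
  refine ⟨?_, ?_⟩
  · -- finite support: a cell all of whose corners are outside `support U` contributes `0`
    refine (Set.finite_iUnion fun c : Corner => hU.preimage (cvert_injective s c).injOn).subset fun ι hι => ?_
    by_contra h
    simp only [Set.mem_iUnion, Set.mem_preimage, not_exists] at h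
    refine hι ?_
    rw [hcell ι]
    refine List.sum_eq_zero fun t ht => ?_
    obtain ⟨T, -, rfl⟩ := List.mem_map.1 ht
    refine List.sum_eq_zero fun t ht => ?_
    obtain ⟨e, -, rfl⟩ := List.mem_map.1 ht
    refine List.sum_eq_zero fun t ht => ?_
    obtain ⟨e', -, rfl⟩ := List.mem_map.1 ht
    exact hT0 e e' _ _ (h e.1)
  · calc ∑' ι, cellNull C a s z U ι
        = ∑' ι, (subTetTable.map fun T => (T.map fun e => (T.map fun e' =>
            Tf e e' (cvert s ι e.1) (cvert s ι e'.1)).sum).sum).sum := tsum_congr hcell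
      _ = (subTetTable.map fun T => (T.map fun e => (T.map fun e' =>
            ∑' ι, Tf e e' (cvert s ι e.1) (cvert s ι e'.1)).sum).sum).sum :=
          tsum_nested subTetTable (fun e e' ι => Tf e e' (cvert s ι e.1) (cvert s ι e'.1)) hsum1
      _ = (subTetTable.map fun T => (T.map fun e => (T.map fun e' =>
            ∑' x : Idx, Tf e e' x (x.1 + (((e'.1.2.2 : ℕ) : ℤ) - ((e.1.2.2 : ℕ) : ℤ)),
              x.2.1 + s (x.1 - ((e.1.2.2 : ℕ) : ℤ)) * (((e'.1.1 : ℕ) : ℤ) - ((e.1.1 : ℕ) : ℤ)),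
              x.2.2 + s (x.1 - ((e.1.2.2 : ℕ) : ℤ)) * (((e'.1.2.1 : ℕ) : ℤ) - ((e.1.2.1 : ℕ) : ℤ)))).sum).sum).sum :=
          by simp only [tsum_corner]
      _ = ∑' x : Idx, (subTetTable.map fun T => (T.map fun e => (T.map fun e' =>
            Tf e e' x (x.1 + (((e'.1.2.2 : ℕ) : ℤ) - ((e.1.2.2 : ℕ) : ℤ)),
              x.2.1 + s (x.1 - ((e.1.2.2 : ℕ) : ℤ)) * (((e'.1.1 : ℕ) : ℤ) - ((e.1.1 : ℕ) : ℤ)),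
              x.2.2 + s (x.1 - ((e.1.2.2 : ℕ) : ℤ)) * (((e'.1.2.1 : ℕ) : ℤ) - ((e.1.2.1 : ℕ) : ℤ)))).sum).sum).sum :=
          (tsum_nested subTetTable (fun e e' x => Tf e e' x (x.1 + (((e'.1.2.2 : ℕ) : ℤ) - ((e.1.2.2 : ℕ) : ℤ)),
              x.2.1 + s (x.1 - ((e.1.2.2 : ℕ) : ℤ)) * (((e'.1.1 : ℕ) : ℤ) - ((e.1.1 : ℕ) : ℤ)),
              x.2.2 + s (x.1 - ((e.1.2.2 : ℕ) : ℤ)) * (((e'.1.2.1 : ℕ) : ℤ) - ((e.1.2.1 : ℕ) : ℤ)))) hsum2).symm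
      _ = 0 := (tsum_congr hpt).trans tsum_zero

end Summit.AtomisticToContinuum.Crystallization.Theorems.UniformPolytypeStabilityCells

end
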